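import Mathlib
import HarnessLib
import Summits.Langlands.Langlands.Theses.ParityBlindBianchi
import Summits.Langlands.Langlands.Theses.RuelleTorsionArtinWeight
import Summits.Langlands.Langlands.Theorems.ParityBlindBianchiArtinWeightRealisationLevelCuspFormsDischarged
import Literature.NumberTheory.Automorphic.PiOfArtinRepHeckeTheoryOnlyProofs
import Literature.NumberTheory.Automorphic.TwistedHeckeTheoryGL2

/-!
# `ArtinWeightRealisationLevel` (R′, crux stmt-Langlands-15111) modulo item stmt-Langlands-11057 and ONE NAMED FACT:
# the twisted Hecke theory of `GL(2)` (`JacquetLanglands1970_twistedHeckeTheoryGL2`)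

Helper file of line `Sketch` (continuation lead c12), `--supports stmt-Langlands-15111`.

Delta recorded here (2026-08-16T18:44Z): the displayed hypothesis `HT` of the accepted reduction
`frobSatakeCompatibleAt_of_isPiOfArtinRep_both_of_heckeTheoryGL2` (`Automorphic/PiOfArtinRepHeckeTheoryOnlyProofs`,
p116514: `HT →` both σ- and π-unramified shadows of Gelbart 1997 Prop. 4.1, with Chevalley's congruence theorem
already the tree theorem `NumberFields.Chevalley1951.vUnits_valuation_sub_one_le`) is now a NAMED Literature fact,
`Literature.NumberTheory.Automorphic.JacquetLanglands1970_twistedHeckeTheoryGL2` (`Automorphic/TwistedHeckeTheoryGL2`;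
Jacquet–Langlands 1970, Thm. 11.1 / Cor. 11.2 with Thm. 2.18, Props. 3.5, 3.6, 3.8(i), Lemma 3.9).  The earlier helper
`…HeckeTheoryGL2.lean` (p118618) carried `HT` as a 40-line displayed binder; this file restates the closure of the crux
against the NAME, so that the residual dependencies of stmt-Langlands-15111 are exactly two tree-tracked objects —
the item stmt-Langlands-11057 (`RuelleTorsionArtinWeight.ArtinWeightRealisation`, NECESSARY: `R′ → R` is
unconditional, `artinWeightRealisation_of_artinWeightRealisationLevel`) and this one named fact:

* `frobSatakeCompatibleAt_of_isPiOfArtinRep_of_isUnramifiedAt_of_JacquetLanglands1970 : JL → hG` (the named fact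
  hG = Gelbart 1997 Prop. 4.1, σ-unramified shadow, from the named fact JL; = p116514 by name);
* `artinWeightRealisationLevel_of_artinWeightRealisation_of_JacquetLanglands1970 : R → JL → R′` — the crux BY NAME
  modulo item stmt-Langlands-11057 and the named fact JL, nothing else (cusp-form existence is the tree theorem
  `nonempty_cuspidalAutomorphicRepData_two_holds`);
* `artinWeightRealisationLevel_iff_artinWeightRealisation_of_JacquetLanglands1970 : JL → (R′ ↔ R)` — the two cruxes
  stmt-Langlands-15111 / stmt-Langlands-11057 are equivalent modulo the named fact JL alone;
* `artinWeightRealisationLevel_of_artinWeightRealisation_insoluble_of_JacquetLanglands1970 : LT → JL → R|A₅ → R′` —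
  modulo the two named facts `strongArtin_of_isSolvable` (Langlands–Tunnell) and JL, the crux reduces to the
  icosahedral (projectively insoluble) sector of the shared a.e. crux R, its honest open core.

No definition and no named fact is introduced; every proof is a one-line composition of landed theorems.
-/

noncomputable section

-- `Summit.Langlands.Langlands.…`: summit = sub-problem name (D-0017 nested layout), not a typo.
set_option linter.dupNamespace false

namespace Summit.Langlands.Langlands.Theorems.ArtinWeightRealisationLevel

open Literature.NumberTheory.Automorphic

/-- **Gelbart 1997 Prop. 4.1, σ-unramified shadow (the named fact
`frobSatakeCompatibleAt_of_isPiOfArtinRep_of_isUnramifiedAt`), from the named fact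
`JacquetLanglands1970_twistedHeckeTheoryGL2`** — by name the theorem
`frobSatakeCompatibleAt_of_isPiOfArtinRep_of_isUnramifiedAt_of_heckeTheoryGL2` (p116514), whose displayed
hypothesis `HT` the named fact restates verbatim (the `fun hcpt π => …` η-expansion unfolds the definition).
[cite: Gelbart1997, Prop. 4.1 (with Thm. 3.2 and Example 3.2.3)]
[cite: JacquetLanglands1970, Thm. 11.1, Cor. 11.2, Lemma 12.5, proof of Thm. 12.2 pp. 209–211] -/
theorem frobSatakeCompatibleAt_of_isPiOfArtinRep_of_isUnramifiedAt_of_JacquetLanglands1970 : Literature.NumberTheory.Automorphic.JacquetLanglands1970_twistedHeckeTheoryGL2 → Literature.NumberTheory.Automorphic.frobSatakeCompatibleAt_of_isPiOfArtinRep_of_isUnramifiedAt :=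
  fun HT => frobSatakeCompatibleAt_of_isPiOfArtinRep_of_isUnramifiedAt_of_heckeTheoryGL2 (fun hcpt π => HT hcpt π)

/-- **R′ from R and the named fact `JacquetLanglands1970_twistedHeckeTheoryGL2`.**  The crux
`ParityBlindBianchi.ArtinWeightRealisationLevel` (stmt-Langlands-15111) BY NAME from the shared a.e. crux
`RuelleTorsionArtinWeight.ArtinWeightRealisation` (item stmt-Langlands-11057) and Jacquet–Langlands' twisted Hecke
theory of `GL(2)` as the named fact; via Gelbart's Prop. 4.1 σ-shadow (previous theorem) and
`artinWeightRealisationLevel_of_artinWeightRealisation_of_gelbart` (p115022).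
[cite: JacquetLanglands1970, Thm. 11.1, Cor. 11.2] [cite: Gelbart1997, Prop. 4.1] -/
theorem artinWeightRealisationLevel_of_artinWeightRealisation_of_JacquetLanglands1970 : Summit.Langlands.Langlands.Theses.RuelleTorsionArtinWeight.ArtinWeightRealisation → Literature.NumberTheory.Automorphic.JacquetLanglands1970_twistedHeckeTheoryGL2 → Summit.Langlands.Langlands.Theses.ParityBlindBianchi.ArtinWeightRealisationLevel :=
  fun hR HT => artinWeightRealisationLevel_of_artinWeightRealisation_of_gelbart hR
    (frobSatakeCompatibleAt_of_isPiOfArtinRep_of_isUnramifiedAt_of_JacquetLanglands1970 HT)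

/-- **The two cruxes are equivalent modulo the named fact `JacquetLanglands1970_twistedHeckeTheoryGL2` alone**:
`ParityBlindBianchi.ArtinWeightRealisationLevel` (stmt-Langlands-15111, every good place) `↔`
`RuelleTorsionArtinWeight.ArtinWeightRealisation` (stmt-Langlands-11057, almost every place); `→` is unconditional
(`artinWeightRealisation_of_artinWeightRealisationLevel`, p108329), `←` is the previous theorem.  Via
`artinWeightRealisationLevel_iff_artinWeightRealisation_of_gelbart` (p115022).
[cite: JacquetLanglands1970, Thm. 11.1, Cor. 11.2] [cite: Gelbart1997, Prop. 4.1] -/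
theorem artinWeightRealisationLevel_iff_artinWeightRealisation_of_JacquetLanglands1970 : Literature.NumberTheory.Automorphic.JacquetLanglands1970_twistedHeckeTheoryGL2 → (Summit.Langlands.Langlands.Theses.ParityBlindBianchi.ArtinWeightRealisationLevel ↔ Summit.Langlands.Langlands.Theses.RuelleTorsionArtinWeight.ArtinWeightRealisation) :=
  fun HT => artinWeightRealisationLevel_iff_artinWeightRealisation_of_gelbart
    (frobSatakeCompatibleAt_of_isPiOfArtinRep_of_isUnramifiedAt_of_JacquetLanglands1970 HT)

/-- **The honest open core, by name.**  Modulo the two named facts `strongArtin_of_isSolvable`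
(Langlands 1980 / Tunnell 1981: strong Artin for `GL₂` in the projectively solvable case) and
`JacquetLanglands1970_twistedHeckeTheoryGL2`, the crux R′ follows from the ICOSAHEDRAL SECTOR of the shared a.e. crux R
alone (irreducible finite-image `σ` with projectively insoluble image, a.e. conclusion); via
`artinWeightRealisationLevel_of_artinWeightRealisation_insoluble_of_gelbart` (p115022).
[cite: JacquetLanglands1970, Thm. 11.1, Cor. 11.2] [cite: Gelbart1997, Prop. 4.1] -/
theorem artinWeightRealisationLevel_of_artinWeightRealisation_insoluble_of_JacquetLanglands1970 : Literature.NumberTheory.Automorphic.strongArtin_of_isSolvable → Literature.NumberTheory.Automorphic.JacquetLanglands1970_twistedHeckeTheoryGL2 → (∀ (K : Type) [Field K] [NumberField K], NumberField.IsTotallyComplex K → Module.finrank ℚ K = 2 → ∀ (p : ℕ) [Fact p.Prime] (ι : PadicAlgCl p ≃+* ℂ) (σ : Literature.NumberTheory.GaloisRepresentations.FramedGaloisRep K (PadicAlgCl p) 2), Finite σ.toMonoidHom.range → σ.toGaloisRep.IsIrreducible → ¬ IsSolvable (Literature.NumberTheory.GaloisRepresentations.projectiveImage σ.toMonoidHom)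 → (∃ (S : Finset (IsDedekindDomain.HeightOneSpectrum (NumberField.RingOfIntegers K))) (U : Subgroup (GL (Fin 2) (IsDedekindDomain.FiniteAdeleRing (NumberField.RingOfIntegers K) K))) (ϖ : ∀ v : IsDedekindDomain.HeightOneSpectrum (NumberField.RingOfIntegers K), (v.adicCompletion K)ˣ) (a : {v : IsDedekindDomain.HeightOneSpectrum (NumberField.RingOfIntegers K) // v ∉ S} → ℕ → (Valued.v (R := PadicAlgCl p)).valuationSubring), (∀ v : IsDedekindDomain.HeightOneSpectrum (NumberField.RingOfIntegers K), ((p : ℕ) : NumberField.RingOfIntegers K) ∈ v.asIdeal → v ∈ S) ∧ IsOpen (U : Set (GL (Fin 2) (IsDedekindDomain.FiniteAdeleRing (NumberField.RingOfIntegers K) K))) ∧ U ≤ Literature.NumberTheory.Automorphic.glFiniteIntegralLevel 2 K ∧ (∀ g ∈ Literature.NumberTheory.Automorphic.glFiniteIntegralLevel 2 K, (∀ v ∈ S, ∀ i j : Fin 2, ((g : Matrix (Fin 2) (Fin 2) (IsDedekindDomain.FiniteAdeleRing (NumberField.RingOfIntegers K) K)) i j) v = (1 : Matrix (Fin 2)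 (Fin 2) (v.adicCompletion K)) i j) → g ∈ U) ∧ (∀ v : IsDedekindDomain.HeightOneSpectrum (NumberField.RingOfIntegers K), Valued.v ((ϖ v : (v.adicCompletion K)ˣ) : v.adicCompletion K) = WithZero.exp (-1 : ℤ)) ∧ Literature.NumberTheory.Automorphic.IsHeckePoint (Matrix.GeneralLinearGroup.map (n := Fin 2) (algebraMap K (IsDedekindDomain.FiniteAdeleRing (NumberField.RingOfIntegers K) K))) (Literature.NumberTheory.Automorphic.LevelTower.ofSeq U (fun r : ℕ => (Literature.NumberTheory.Automorphic.principalCongruenceLevel 2 K (Ideal.span {((p : ℕ) : NumberField.RingOfIntegers K)} ^ r)).map (Literature.NumberTheory.Automorphic.GLn.sndHom 2 K))) ((p : ℕ) : (Valued.v (R := PadicAlgCl p)).valuationSubring) (fun j : {v : IsDedekindDomain.HeightOneSpectrum (NumberField.RingOfIntegers K) // v ∉ S} × Fin 2 => Literature.NumberTheory.Automorphic.GLn.sndHom 2 K (Literature.NumberTheory.Automorphic.heckeDiagAt 2 K j.1.1 (ϖ j.1.1) (j.2.val + 1))) (fun j => a j.1 (j.2.val + 1)) ∧ ∀ (v : IsDedekindDomain.HeightOneSpectrum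 (NumberField.RingOfIntegers K)) (hv : v ∉ S), σ.IsHeckeAssociatedAt v (fun i : ℕ => if i = 0 then (1 : PadicAlgCl p) else ((a ⟨v, hv⟩ i : (Valued.v (R := PadicAlgCl p)).valuationSubring) : PadicAlgCl p))) → ∃ (hcpt : Literature.NumberTheory.Automorphic.isCompact_glFiniteIntegralLevel 2 K) (π : Literature.NumberTheory.Automorphic.CuspidalAutomorphicRepData 2 K hcpt), ∀ᶠ w : IsDedekindDomain.HeightOneSpectrum (NumberField.RingOfIntegers K) in Filter.cofinite, Summit.Langlands.SatakeFrobCompatibleAt ι π.1 σ w) → Summit.Langlands.Langlands.Theses.ParityBlindBianchi.ArtinWeightRealisationLevel :=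
  fun hLT HT hA5 => artinWeightRealisationLevel_of_artinWeightRealisation_insoluble_of_gelbart hLT
    (frobSatakeCompatibleAt_of_isPiOfArtinRep_of_isUnramifiedAt_of_JacquetLanglands1970 HT) hA5

end Summit.Langlands.Langlands.Theorems.ArtinWeightRealisationLevel

end
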